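import Summits.BirchSwinnertonDyer.Rank1Residual.ManinAdditive.CMTwinGammaOneLawUnitClass
import HarnessLib

/-!
# §45.D: THEOREM 45⁺⁺ — the ROOT `Γ₁`-law at the CM prime on EVERY CM class: E-es-152₂ / E-es-152₃, proved edges onto
E-es-136, 147, 148, 149, 150, 151, and COR 45.R (C2 / C3 on the whole CM slice)
(cell `bsd-f2-manin`, planner `-es` g31; follow-up leaf to `CMTwinGammaOneLawUnitClass` (T-es-49, p724151); source
HOME/es/g31/CMGammaOneRootLaw-es-g31.lean; paper proof HOME/MEMO-es.md §45.D, audit R-es-71 pending)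

TYPER NOTE (typer g20, T-es-50 + CORRECTION).  LANDED FIRST (p725942) from HOME/es/g31/CMGammaOneRootLaw-es-g31.lean sha16 e796e2971d0fe473;
this APPEND brings the file to es's corrected leaf sha16 63102c91832cf892 (190+ l.; es: farm rc 0 · 0 err · 0 warn · 0 s∗rry; BC7 2/2 CLEAN
Probe3-es-g31.out.txt fc5d89ce9440aeef): VERBATIM except this note — the delta is the R₀-wording fix of the module docstring above plus THREE NEW
theorems appended at the end of section EsG31D (KERNEL `not_dvd_maninConstant₁_of_rootLaw_of_witness` and COR 45.S₂/S₃
`not_two/three_dvd_maninConstant₁_on_cmClass_two/three_of_rootLaw`: the p-part of Stevens' `c₁ = ±1` on the CM slice from E-es-152 ALONE, via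
`Gamma1ParametrizationData.IsOptimal`); no landed declaration is changed (append-only).  `@[conjecture]` on **E-es-152₂/152₃
`CMGammaOneRootLawTwoLocal/ThreeLocal`** (ROOT Γ₁-law on EVERY CM-by-O_K class; theorem candidates with es's paper proof THM 45⁺⁺ = orbit factor,
audit R-es-71 pending at landing time; obligation nodes until kernel-checked).  PROVED (es) edges E-152 ⟹ E-148₂, E-136₂/₃ (tree
`CMRootGammaOneLatticeLaw{Two,Three}Local` of `CMTwinStevensMinimal`), E-147₂/₃, E-149₃, E-150₃, E-151₃, COR 45.R₂⁺/R₃⁺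
(`not_two/three_dvd_maninConstant_on_cmClass_two/three_of_rootLaw`: C2 / C3 on the whole CM slice ⟸ E-152 ∧ E-es-133⁺ ∧ Faltings) and COR 45.S₂/S₃.
After this file the CM Γ₁-subgraph has ONE open root per prime (E-es-152_p) besides E-es-133⁺_p.  Imports = `CMTwinGammaOneLawUnitClass` (p724151)
only — ROUTE-INDEPENDENT.  NOT IN PRINT (Stevens (7.1) covers N ≤ 200 only).

THEOREM 45⁺⁺ (paper).  For every elliptic curve `E/ℚ` with CM by `ℤ[i]` (`j = 1728`, `p = 2`) or `ℤ[ζ₃]` (`j = 0`, `p = 3`), every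
newform `f` of its class and EVERY globally minimal model `V` of ANY member of the class: `Λ₁(f) ⊆ Λ(V) ⊗ ℤ_(p)` — the `p`-part of
Stevens' `Γ₁`-conjecture holds on the whole CM slice (THEOREM 45 gave it off the strata `{27 ∥ N}`, `{32 ∥ N, 64 ∥ N}`, where only the
PARTNER law `Λ₁(f) ⊆ Λ(V') ⊗ ℤ_(p)` was reached; THEOREM 45⁺ closed `{27 ∥ N, a = 0}`).  New input = the ORBIT FACTOR: in the notation
of THEOREM 45 / 45⁺ (module docstrings of `CMTwinGammaOneLaw`, `CMTwinGammaOneLawUnitClass`), after the ray-class trace the class value is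
`G(1) = -u_m Σ_{i≥1} [ t^{2i-1} U^{-i} S'_{i,0} + t^{2i} U^{-i} S'_{i-1,1} ]` (`t = t_β`, `v_π(t) = 1/((q-1)q^{k-1})`, `U` a unit,
`v_π(u_m) = υ = v_p(Δ_V)/6·(e/2)`), with `S'_{i,j} = Σ_{(ρ,γ)} ε_o(ρ) Δe(Nγ) x'(Q)^i y'(Q)^j` over `R = (O/𝔣_o)^× × (O/ℓ)`, `x', y'` the
coordinates of the ODD-order points `Q` on the good-reduction model over `F_𝔓 = K(E[𝔣_o ℓ])_𝔓`.  (i) ORBIT FACTOR LEMMA: `μ_{w_K}` acts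
freely on `R` and `term(u·(ρ,γ)) = ε_o(u) u^{-wt m} term(ρ,γ)`, so on the ORIGINAL model `S_m = w_K·[wt m ≡ a (mod w_K)]·Σ_{R₀}^m` (`R₀ = C₀ × (O/ℓ)`, `C₀` orbit representatives in `(O/𝔣_o)^×`) with
`v_π(w_K) = v_π(6) = 2` (`p = 3`), `= v_π(4) = 4` (`p = 2`) — THEOREM 45⁺ used only the vanishing half; (ii) `c_{R₀} := Σ_{R₀} ε_o Δe = (Σ_{C₀} ε_o)(Σ_γ Δe(Nγ)) = 0`
(`Σ_γ Δe(Nγ) = ℓ* − ℓ* = 0`), which kills the `Q`-independent terms of `λ'`; (iii) the change of model `x' = u^{-2}(x - r)`, `y' = u^{-3}(y - s(x-r) - t₀)` (`r, s, t₀ ∈ O_{F_𝔓}`) gives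
`S'_{1,0} = u^{-2} S_x`, `S'_{0,1} = u^{-3}(S_y - s S_x)`, `S'_{2,0} = u^{-4}(S_{x²} - 2r S_x)`, `S'_{1,1} = u^{-5}[S_{xy} - s S_{x²} - r S_y
+ (2rs - t₀) S_x]`, and integrality of `x', y'` on `R₀` with (ii) gives `v(Σ_{R₀}^x) ≥ 2υ`, `v(Σ_{R₀}^{x²}) ≥ min(4υ, v(2)+2υ)`, `v(Σ_{R₀}^y) ≥ min(3υ, v(s)+2υ)`,
`v(Σ_{R₀}^{xy}) ≥ 2` (`p = 2`).  (iv) TERM TABLE (thresholds: every term of `G(1)/1` must exceed `1` at `(3, k=2)`, `2` at `(2, k=3)`, `3/2`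
at `(2, k=4)` after the trace `ℚ(ζ₈) → K`; all other strata are THEOREM 45): `(3,2), a=2`: `S_x ≥ 2+½·2 = 3 ⟹ S'_{1,0}, S'_{0,1} ≥ 2,
S'_{2,0} ≥ 1`, min term `A₂ = ½+3/6+1 = 2 > 1`; `(2,3)` and `(2,4)`, `a=2`: `S_x ≥ 4+2 = 6 ⟹ S'_{1,0}, S'_{2,0} ≥ 4, S'_{0,1} ≥ 3,
S'_{1,1} ≥ 1`, min term `A₃ = 1+5/4 > 2` resp. `1+5/8 = 13/8 > 3/2`; `a=0`: `S_{x²} ≥ 4+4 = 8 ⟹ S'_{2,0} ≥ 4, S'_{1,1} ≥ 3`; `(2,4), a=3`: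
`S_y ≥ 6 ⟹ S'_{0,1} ≥ 3, S'_{1,1} ≥ 1`; `a=1`: `S_{xy} ≥ 6 ⟹ S'_{1,1} ≥ 1`.  Hence `v_π(G(1)) ≥ 2 / 3 / 2` = `v_π(D/Ω'_V) ≥ 0` on
the three strata, for every globally minimal model (both twins).  BC5 (exact, HOME/es/g31/ENGINEC-HP-v1.txt ae2bc32371d16dae, 33 classes,
0 violations, bound ATTAINED on `B = 4, -4, 5, -7` (`v = 2`), `A = -5` (`v = 3`), `A = 5, k = 4` (`v_𝔓 = 4`)); CM-PARTNER-v1.txt: root law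
(`δ_obs ≤ 0`) observed on all 39 classes; SXNORM-{w,i}.txt: `v(S_x) = 3 / 6`, `v(S_{x²}) = 8` = the orbit-factor bounds exactly.
BC7: HOME/es/g31/Probe3-es-g31.out.txt.  No instances, no notation.
PARTITION 0 · beyond-print theorem: candidate (paper) · bears_on stmt-BirchSwinnertonDyer-22967 / 22968 · BSD is not proved by this.
-/

set_option autoImplicit false

noncomputable section

namespace Summit.BirchSwinnertonDyer.Rank1Residual.ManinAdditive.KatoCurve.CMTwinMinimal

open scoped MatrixGroups ModularForm
open CongruenceSubgroup WeierstrassCurve Literature.NumberTheory.EllipticCurves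
  Literature.NumberTheory.EllipticCurves.ModularForms
  Summit.BirchSwinnertonDyer.Rank1Residual.ManinAdditive.KatoCurve.CMOptimal

section EsG31D

/-- **E-es-152₂ `CMGammaOneRootLawTwoLocal`** (THEOREM-candidate, THM 45⁺⁺, `p = 2`): for EVERY globally minimal `V/ℚ` with
`c₆(V) = 0` (`j = 1728`) and every newform `f` of its class, `Λ₁(f) ⊆ Λ(V) ⊗ ℤ_(2)`. -/
@[conjecture]
def CMGammaOneRootLawTwoLocal : Prop :=
  ∀ (V : WeierstrassCurve ℚ) [V.IsElliptic] [V.IsGloballyMinimal] {N : ℕ} [NeZero N]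
    (f : CuspForm (Gamma0 N) 2) (L : PeriodPair),
    V.c₆ = 0 → IsNewformOf V f → IsNeronLatticeOf (V.baseChange ℂ) L →
    ∀ z ∈ periodLatticeGamma1 f, ∃ s : ℤ, ¬ (2 : ℤ) ∣ s ∧ (s : ℂ) * z ∈ L.lattice

/-- **E-es-152₃ `CMGammaOneRootLawThreeLocal`** (THEOREM-candidate, THM 45⁺⁺, `p = 3`): for EVERY globally minimal `V/ℚ` with
`c₄(V) = 0` (`j = 0`) and every newform `f` of its class, `Λ₁(f) ⊆ Λ(V) ⊗ ℤ_(3)`. -/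
@[conjecture]
def CMGammaOneRootLawThreeLocal : Prop :=
  ∀ (V : WeierstrassCurve ℚ) [V.IsElliptic] [V.IsGloballyMinimal] {N : ℕ} [NeZero N]
    (f : CuspForm (Gamma0 N) 2) (L : PeriodPair),
    V.c₄ = 0 → IsNewformOf V f → IsNeronLatticeOf (V.baseChange ℂ) L →
    ∀ z ∈ periodLatticeGamma1 f, ∃ s : ℤ, ¬ (3 : ℤ) ∣ s ∧ (s : ℂ) * z ∈ L.lattice

/-! ## Proved edges: 152 ⟹ every earlier CM `Γ₁`-law node (148₂, 136₂, 147₂; 149₃, 150₃, 151₃, 136₃, 147₃). -/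

/-- E-es-152₂ ⟹ E-es-148₂ (`CMGammaOneRootLawTwoLocalAt256`): drop the level hypothesis. -/
theorem cmGammaOneRootLawTwoLocalAt256_of_rootLaw (h : CMGammaOneRootLawTwoLocal) :
    CMGammaOneRootLawTwoLocalAt256 :=
  fun V _ _ _ _ f L h6 hf _ hL => h V f L h6 hf hL

/-- E-es-152₂ ⟹ E-es-136₂ (`CMRootGammaOneLatticeLawTwoLocal`, tree `CMTwinStevensMinimal`): drop the root binder. -/
theorem cmRootGammaOneLatticeLawTwoLocal_of_rootLaw (h : CMGammaOneRootLawTwoLocal) :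
    CMRootGammaOneLatticeLawTwoLocal := by
  intro V _ _ N _ f L hroot hf hL
  obtain ⟨a, -, -, h6⟩ := hroot
  exact h V f L h6 hf hL

/-- E-es-152₂ ⟹ E-es-147₂ (`CMTwinGammaOneLawTwoLocal`): apply the root law to the partner `V'` itself
(`IsNewformOf` is isogeny-invariant given `LFunction_eq_of_isIsogenous`; the dual isogeny is `IsIsogenous.symm_of_charZero`). -/
theorem cmTwinGammaOneLawTwoLocal_of_rootLaw (hL : LFunction_eq_of_isIsogenous) (h : CMGammaOneRootLawTwoLocal) :
    CMTwinGammaOneLawTwoLocal := by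
  intro V V' _ _ _ _ N _ f L' _ hf hiso' _ hc₆ hL'
  exact h V' f L' hc₆ (isNewformOf_of_isIsogenous hL hf (IsIsogenous.symm_of_charZero hiso')) hL'

/-- E-es-152₃ ⟹ E-es-149₃ (`CMGammaOneRootLawThreeLocalOff27`). -/
theorem cmGammaOneRootLawThreeLocalOff27_of_rootLaw (h : CMGammaOneRootLawThreeLocal) :
    CMGammaOneRootLawThreeLocalOff27 :=
  fun V _ _ _ _ f L h4 hf _ hL => h V f L h4 hf hL

/-- E-es-152₃ ⟹ E-es-150₃ (`CMGammaOneRootLawThreeLocalAt27UnitClass`). -/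
theorem cmGammaOneRootLawThreeLocalAt27UnitClass_of_rootLaw (h : CMGammaOneRootLawThreeLocal) :
    CMGammaOneRootLawThreeLocalAt27UnitClass :=
  fun V _ _ _ _ f L h4 hf _ _ _ hL => h V f L h4 hf hL

/-- E-es-152₃ ⟹ E-es-151₃ (`CMGammaOneRootLawThreeLocalOffWildNonUnit`). -/
theorem cmGammaOneRootLawThreeLocalOffWildNonUnit_of_rootLaw (h : CMGammaOneRootLawThreeLocal) :
    CMGammaOneRootLawThreeLocalOffWildNonUnit :=
  fun V _ _ _ _ f L h4 hf _ hL => h V f L h4 hf hL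

/-- E-es-152₃ ⟹ E-es-136₃ (`CMRootGammaOneLatticeLawThreeLocal`, tree `CMTwinStevensMinimal`): drop the root binder. -/
theorem cmRootGammaOneLatticeLawThreeLocal_of_rootLaw (h : CMGammaOneRootLawThreeLocal) :
    CMRootGammaOneLatticeLawThreeLocal := by
  intro V _ _ N _ f L hroot hf hL
  obtain ⟨B, -, h4, -⟩ := hroot
  exact h V f L h4 hf hL

/-- E-es-152₃ ⟹ E-es-147₃ (`CMTwinGammaOneLawThreeLocal`). -/
theorem cmTwinGammaOneLawThreeLocal_of_rootLaw (hL : LFunction_eq_of_isIsogenous) (h : CMGammaOneRootLawThreeLocal) :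
    CMTwinGammaOneLawThreeLocal := by
  intro V V' _ _ _ _ N _ f L' _ hf hiso' hc₄ _ hL'
  exact h V' f L' hc₄ (isNewformOf_of_isIsogenous hL hf (IsIsogenous.symm_of_charZero hiso')) hL'

variable {N : ℕ} [NeZero N]

/-- **COR 45.R₂⁺ (C2 on the whole `j = 1728` slice from the ROOT law E-es-152₂; no partner curve, no level stratum):**
hypotheses as COR 45.R₂ of `CMTwinGammaOneLaw` with `2⁸ ∣ N` replaced by `2² ∣ N` (automatic on the slice: `2⁵ ∣ N`). -/
theorem not_two_dvd_maninConstant_on_cmClass_two_of_rootLaw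
    (h152 : CMGammaOneRootLawTwoLocal) (hmin : CMTwinStevensMinimalTwo) (hL : LFunction_eq_of_isIsogenous)
    (W : WeierstrassCurve ℚ) [W.IsElliptic] [W.IsGloballyMinimal]
    (D : ModularParametrizationData W N)
    (hD : ∀ z ∈ D.L.lattice, ∃ w ∈ periodLattice D.f, z = D.c * w)
    (V : WeierstrassCurve ℚ) [V.IsElliptic] [V.IsGloballyMinimal] (LV : PeriodPair) (h6 : V.c₆ = 0)
    (hiso : WeierstrassCurve.IsIsogenous V W) (hLV : IsNeronLatticeOf (V.baseChange ℂ) LV)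
    (hred : ∀ (W' : WeierstrassCurve ℚ) [W'.IsElliptic] [W'.IsGloballyMinimal],
        W'.j = 1728 → WeierstrassCurve.IsIsogenous V W' → (W'.c₄ = V.c₄ ∨ W'.c₄ = -4 * V.c₄))
    (hwit : ∃ z ∈ LV.lattice, ∀ s : ℤ, ¬ (2 : ℤ) ∣ s → ∀ m ∈ LV.lattice, (s : ℂ) * z ≠ 2 * m)
    {q : ℕ} (hq : q.Prime) (hq2 : q ≠ 2) (h4 : 2 ^ 2 ∣ N) (hqN : q ^ 2 ∣ N) :
    ¬ (2 : ℤ) ∣ D.maninConstant := by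
  have hjV : V.j = 1728 := by
    have hΔ : V.Δ ≠ 0 := by rw [← WeierstrassCurve.coe_Δ']; exact V.Δ'.ne_zero
    have hc : V.c₄ ^ 3 = 1728 * V.Δ := by
      have := V.c_relation; rw [h6] at this; linear_combination -this
    rw [WeierstrassCurve.j, Units.val_inv_eq_inv_val, WeierstrassCurve.coe_Δ', hc]
    field_simp
  have hfV : IsNewformOf V D.f := isNewformOf_of_isIsogenous hL D.isNewformOf hiso
  have heq := ModularForms.gamma1LatticeEqOfTwoTracelessPrimes_holds N D.f hfV.1 2 q Nat.prime_two hq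
    (Ne.symm hq2) ((dvd_pow_self 2 two_ne_zero).trans h4) ((dvd_pow_self q two_ne_zero).trans hqN)
    (hfV.1.cuspCoeff_eq_zero_of_sq_dvd Nat.prime_two h4) (hfV.1.cuspCoeff_eq_zero_of_sq_dvd hq hqN)
  obtain ⟨z, hz, hzM⟩ := hwit
  refine not_dvd_maninConstant_of_saturated_mem_of_witness D hD Int.prime_two LV.lattice
    (fun γ => h152 V D.f LV h6 hfV hLV _ ?_)
    ⟨z, hmin V W LV D.L hjV hiso hLV D.isNeronLattice hred hz, fun s hs m hm => ?_⟩
  · rw [heq]; unfold periodLattice; exact AddSubgroup.subset_closure ⟨γ, rfl⟩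
  · exact_mod_cast hzM s hs m hm

/-- **COR 45.R₃⁺ (C3 on the whole `j = 0` slice from the ROOT law E-es-152₃; no partner curve, no level stratum):**
hypotheses as COR 45.R₃ of `CMTwinGammaOneLawUnitClass` with `27 ∥ N` and the class hypothesis replaced by `3² ∣ N`
(automatic on the slice: `3² ∣ N` always, `3³ ∣ N` at additive reduction). -/
theorem not_three_dvd_maninConstant_on_cmClass_three_of_rootLaw
    (h152 : CMGammaOneRootLawThreeLocal) (hmin : CMTwinStevensMinimalThree)
    (hL : LFunction_eq_of_isIsogenous)
    (W : WeierstrassCurve ℚ) [W.IsElliptic] [W.IsGloballyMinimal]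
    (D : ModularParametrizationData W N)
    (hD : ∀ z ∈ D.L.lattice, ∃ w ∈ periodLattice D.f, z = D.c * w)
    (V : WeierstrassCurve ℚ) [V.IsElliptic] [V.IsGloballyMinimal] (LV : PeriodPair) (h4 : V.c₄ = 0)
    (hiso : WeierstrassCurve.IsIsogenous V W) (hLV : IsNeronLatticeOf (V.baseChange ℂ) LV)
    (hred : ∀ (W' : WeierstrassCurve ℚ) [W'.IsElliptic] [W'.IsGloballyMinimal],
        W'.j = 0 → WeierstrassCurve.IsIsogenous V W' → (W'.c₆ = V.c₆ ∨ W'.c₆ = -27 * V.c₆))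
    (hwit : ∃ z ∈ LV.lattice, ∀ s : ℤ, ¬ (3 : ℤ) ∣ s → ∀ m ∈ LV.lattice, (s : ℂ) * z ≠ 3 * m)
    {q : ℕ} (hq : q.Prime) (hq3 : q ≠ 3) (h9 : 3 ^ 2 ∣ N) (hqN : q ^ 2 ∣ N) :
    ¬ (3 : ℤ) ∣ D.maninConstant := by
  have hjV : V.j = 0 := by simp [WeierstrassCurve.j, h4]
  have hfV : IsNewformOf V D.f := isNewformOf_of_isIsogenous hL D.isNewformOf hiso
  have heq := ModularForms.gamma1LatticeEqOfTwoTracelessPrimes_holds N D.f hfV.1 3 q Nat.prime_three hq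
    (Ne.symm hq3) ((dvd_pow_self 3 two_ne_zero).trans h9) ((dvd_pow_self q two_ne_zero).trans hqN)
    (hfV.1.cuspCoeff_eq_zero_of_sq_dvd Nat.prime_three h9) (hfV.1.cuspCoeff_eq_zero_of_sq_dvd hq hqN)
  obtain ⟨z, hz, hzM⟩ := hwit
  refine not_dvd_maninConstant_of_saturated_mem_of_witness D hD Int.prime_three LV.lattice
    (fun γ => h152 V D.f LV h4 hfV hLV _ ?_)
    ⟨z, hmin V W LV D.L hjV hiso hLV D.isNeronLattice hred hz, fun s hs m hm => ?_⟩
  · rw [heq]; unfold periodLattice; exact AddSubgroup.subset_closure ⟨γ, rfl⟩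
  · exact_mod_cast hzM s hs m hm

/-- **KERNEL for COR 45.S** (the `Γ₁` twin of `not_dvd_maninConstant_of_saturated_mem_of_witness`): an OPTIMAL `X₁(N)`-datum `D`
of `V` (`Λ_V = c₁ · Λ₁(f)`), the root law `Λ₁(f) ⊆ Λ_V ⊗ ℤ_(p)` AT `V` ITSELF, and one vector `z ∈ Λ_V` with `s z ∉ p Λ_V` for all `s`
prime to `p`; then `p ∤ c₁`.  Proof: `z = c₁ w`, `s w ∈ Λ_V`; if `c₁ = p c'` then `s z = p · (c' s w) ∈ p Λ_V`. -/
theorem not_dvd_maninConstant₁_of_rootLaw_of_witness {V : WeierstrassCurve ℚ} (D : Gamma1ParametrizationData V N)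
    (hopt : D.IsOptimal) {p : ℤ}
    (hsat : ∀ w ∈ periodLatticeGamma1 D.f, ∃ s : ℤ, ¬ p ∣ s ∧ (s : ℂ) * w ∈ D.L.lattice)
    (hz : ∃ z ∈ D.L.lattice, ∀ s : ℤ, ¬ p ∣ s → ∀ m ∈ D.L.lattice, (s : ℂ) * z ≠ (p : ℂ) * m) :
    ¬ p ∣ D.maninConstant := by
  obtain ⟨z, hzL, hzM⟩ := hz
  obtain ⟨w, hw, hw'⟩ := hopt z hzL
  obtain ⟨s, hs, hsw⟩ := hsat w hw
  change ¬ p ∣ D.c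
  rintro ⟨c', hc'⟩
  refine hzM s hs (c' • ((s : ℂ) * w)) (D.L.lattice.smul_mem c' hsw) ?_
  rw [hw', hc', zsmul_eq_mul]; push_cast; ring

/-- **COR 45.S₂ — the `2`-part of STEVENS' `c₁ = ±1` on the `ℚ(i)`-CM slice, from E-es-152₂ alone**: for every globally minimal `V`
with `c₆(V) = 0` that is the `X₁(N)`-OPTIMAL curve of its class (optimal datum `D`) and carries a vector `z ∈ Λ_V ∖ 2(Λ_V ⊗ ℤ_(2))`
(any primitive vector), `2 ∤ c₁(V)`.  No `E-es-133⁺`, no traceless prime, no level hypothesis.  (With THEOREM 45⁺⁺ for the OTHER twin it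
also pins `V` = the SMALL twin: `Λ(V) ⊗ ℤ_(2) = Λ₁ ⊗ ℤ_(2) ⊆ Λ(V_small) ⊗ ℤ_(2)`.) -/
theorem not_two_dvd_maninConstant₁_on_cmClass_two_of_rootLaw (h152 : CMGammaOneRootLawTwoLocal)
    (V : WeierstrassCurve ℚ) [V.IsElliptic] [V.IsGloballyMinimal] (D : Gamma1ParametrizationData V N)
    (hopt : D.IsOptimal) (h6 : V.c₆ = 0)
    (hz : ∃ z ∈ D.L.lattice, ∀ s : ℤ, ¬ (2 : ℤ) ∣ s → ∀ m ∈ D.L.lattice, (s : ℂ) * z ≠ ((2 : ℤ) : ℂ) * m) :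
    ¬ (2 : ℤ) ∣ D.maninConstant :=
  not_dvd_maninConstant₁_of_rootLaw_of_witness D hopt (h152 V D.f D.L h6 D.isNewformOf D.isNeronLattice) hz

/-- **COR 45.S₃ — the `3`-part of STEVENS' `c₁ = ±1` on the `ℚ(√-3)`-CM slice, from E-es-152₃ alone** (as COR 45.S₂ with `c₄(V) = 0`,
`p = 3`). -/
theorem not_three_dvd_maninConstant₁_on_cmClass_three_of_rootLaw (h152 : CMGammaOneRootLawThreeLocal)
    (V : WeierstrassCurve ℚ) [V.IsElliptic] [V.IsGloballyMinimal] (D : Gamma1ParametrizationData V N)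
    (hopt : D.IsOptimal) (h4 : V.c₄ = 0)
    (hz : ∃ z ∈ D.L.lattice, ∀ s : ℤ, ¬ (3 : ℤ) ∣ s → ∀ m ∈ D.L.lattice, (s : ℂ) * z ≠ ((3 : ℤ) : ℂ) * m) :
    ¬ (3 : ℤ) ∣ D.maninConstant :=
  not_dvd_maninConstant₁_of_rootLaw_of_witness D hopt (h152 V D.f D.L h4 D.isNewformOf D.isNeronLattice) hz

end EsG31D

end Summit.BirchSwinnertonDyer.Rank1Residual.ManinAdditive.KatoCurve.CMTwinMinimal

end
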